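import Literature.Probability.Percolation.LowestCrossing
import HarnessLib

/-!
# A primal top–bottom walk and a dual left–right face-walk of a rectangle cross (transposed form)

Topic `Literature/Probability/Percolation`; proofs only (no definition, no named fact). A
bottom-up layer towards `Kesten1987_zdKestenRelation` (`ZdNearCriticalWindow.lean`), prepared
for the planar extraction step of the five-arm construction for bond percolation on `ℤ²`: the
colour-blind crossing fact `exists_dart_sepEdge_mem_edges` of `PlanarDuality.lean` (a primal
LEFT–RIGHT walk of `R = [0,M] × [0,N]` and a face walk from a TOP face to a BOTTOM face of the
dual rectangle cross; Kesten 1982, §2.2–2.3; Bollobás–Riordan 2006, Ch. 3, Lemma 1), transported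
along the transposition `transposeIso` of `ℤ²` (`LatticeSymmetry.lean`; the transposition lemmas
`transposeIso_sepLo`, `transposeIso_sepHi` of `LowestCrossing.lean`) to the orientation used by
an exploration from the bottom side: a primal BOTTOM–TOP walk of `R` and a face walk of the
vertical dual `[-1, M] × [0, N-1]` from a face right of `R` to a face left of `R` cross.

* `exists_dart_sepEdge_mem_edges_tb` — the crossing step.
-/

noncomputable section

open Set SimpleGraph

namespace Literature.Probability.Percolation

open LatticeModels

/-- The edge separating two transposed adjacent faces is the transpose of the separating edge.
[folklore] -/
theorem sepEdge_transposeIso {z z' : Site 2} (h : (zdGraph 2).Adj z z') :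
    sepEdge (transposeIso z) (transposeIso z') = Sym2.map transposeIso (sepEdge z z') := by
  rw [sepEdge, sepEdge, Sym2.map_mk, transposeIso_sepLo, transposeIso_sepHi h]

/-- **A bottom–top lattice walk of `R` and a right–left face walk of the vertical dual cross**
(transposed form of `exists_dart_sepEdge_mem_edges`; Kesten 1982, §2.2–2.3; Bollobás–Riordan
2006, Ch. 3, Lemma 1): if `P` is a walk of `ℤ²` inside `R = [0,M] × [0,N]` from the bottom side
(`a 1 = 0`) to the top side (`b 1 = N`) and `Q` is a walk of faces (lower-left corners) inside
`[-1, M] × [0, N-1]` from a face with `t 0 = M` to a face with `s 0 = -1`, then some dart of `Q`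
crosses an edge of `P`. [cite: BollobasRiordan2006, Ch. 3, Lemma 1] [cite: KestenPTM1982, §2.2–2.3] -/
theorem exists_dart_sepEdge_mem_edges_tb {M N : ℕ} {a b t s : Site 2}
    (P : (zdGraph 2).Walk a b) (Q : (zdGraph 2).Walk t s)
    (hP : ∀ z ∈ P.support, 0 ≤ z 0 ∧ z 0 ≤ M ∧ 0 ≤ z 1 ∧ z 1 ≤ N)
    (hQ : ∀ z ∈ Q.support, -1 ≤ z 0 ∧ z 0 ≤ M ∧ 0 ≤ z 1 ∧ z 1 + 1 ≤ N)
    (ha : a 1 = 0) (hb : b 1 = N) (ht : t 0 = M) (hs : s 0 = -1) :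
    ∃ dq ∈ Q.darts, sepEdge dq.fst dq.snd ∈ P.edges := by
  classical
  set T := transposeIso.toEmbedding.toHom with hT
  have hTapply : ∀ x : Site 2, T x = transposeIso x := fun x => rfl
  obtain ⟨dq', hdq', hsep⟩ := exists_dart_sepEdge_mem_edges (M := N) (N := M) (P.map T) (Q.map T)
    (fun z hz => by
      rw [Walk.support_map, List.mem_map] at hz
      obtain ⟨w, hw, rfl⟩ := hz
      have := hP w hw
      rw [hTapply, transposeIso_apply_zero, transposeIso_apply_one]
      omega)
    (fun z hz => by
      rw [Walk.support_map, List.mem_map] at hz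
      obtain ⟨w, hw, rfl⟩ := hz
      have := hQ w hw
      rw [hTapply, transposeIso_apply_zero, transposeIso_apply_one]
      omega)
    (by show transposeIso a 0 = 0; rw [transposeIso_apply_zero, ha])
    (by show transposeIso b 0 = (N : ℤ); rw [transposeIso_apply_zero, hb])
    (by show transposeIso t 1 = (M : ℤ); rw [transposeIso_apply_one, ht])
    (by show transposeIso s 1 = -1; rw [transposeIso_apply_one, hs])
  rw [Walk.darts_map, List.mem_map] at hdq'
  obtain ⟨dq, hdq, rfl⟩ := hdq'
  refine ⟨dq, hdq, ?_⟩
  have hsep' : Sym2.map transposeIso (sepEdge dq.fst dq.snd) ∈ (P.map T).edges := by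
    rw [← sepEdge_transposeIso dq.adj]; exact hsep
  rw [Walk.edges_map, List.mem_map] at hsep'
  obtain ⟨e, he, hee⟩ := hsep'
  have hinj : Function.Injective (Sym2.map transposeIso) := Sym2.map.injective transposeIso.injective
  have : e = sepEdge dq.fst dq.snd := hinj (by rw [← hee]; rfl)
  exact this ▸ he

end Literature.Probability.Percolation
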